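import Literature.Geometry.Lorentzian.ADMTailCoefficientClass
import HarnessLib

/-!
# Late-time forcing decay of an ADM coefficient tuple (Ellithy 2026, Definition 3.28)

A. Ellithy, *The spacetime Penrose inequality under a quasi final state hypothesis*,
arXiv:2605.18730 (2026), §3.4 (p. 34). "For a tail radius `r₁ > r₀` and `T ≥ T̲`, define
`G_{r₁}(T) := ∫_{r₁}^∞ 𝔛₀(r,T)/r dr`, `Φ_{1,r₁}(T) := ∫_{r₁}^∞ 𝔛₁(r,T) dr`,
`Φ_{2,r₁}(T) := ∫_{r₁}^∞ 𝔛₂(r,T) dr`, `Ω_{r₁}(T) := sup_{r ≥ r₁} 𝔛₀(r,T)`,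
`Ψ_{r₁}(T) := sup_{t ≥ T} ‖r Ξ(t, ·)‖_{C^{α,α/2}_{-τ}(M_{r₁,∞})}`. By Definition 3.6, all these
quantities are finite for every `r₁ > r₀` and every `T ≥ T̲`."

**Definition 3.28** (Late-time forcing decay, p. 34). "We define the following late-time forcing
decay assumptions: (A1) For every `r₁ > r₀`, `G_{r₁}(T) → 0` and `Φ_{1,r₁}(T) → 0` as `T → ∞`.
(A2) For every `r₁ > r₀`, `Φ_{2,r₁}(T) → 0` and `Ω_{r₁}(T) → 0` as `T → ∞`. (A3) For every `r₁ > r₀`,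
`Ψ_{r₁}(T) → 0` as `T → ∞`."  Remark 3.30: "(A1) is the basic continuation assumption … (A2) is the
direct pointwise assumption used to control `r²|∇̸²f|` and `(N/λ)|f_r|` … (A3) plays the same
upgrading role as (A2), but through the truncated Schauder estimate".

The tail-size functions `𝔛₀, 𝔛₁, 𝔛₂` (`ADMTailTuple.X0/X1/X2`), the forcing `Ξ`
(`ADMTailTuple.forcing`) and the weighted Hölder norm `‖·‖_{C^{α,α/2}_{-τ}}` (`czWeightedNorm`) are in
`ADMTailCoefficientClass` / `ExteriorTailHolderSpaces`. This is part D37′c of the typing of the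
quasi final state hypothesis (Def. 4.4, bullet 2: "(A1) holds, and in addition either (A2) or (A3)
holds"; file `QuasiFinalAnalytic`). Integrals are lower Lebesgue integrals over `Ioi r₁`, all
quantities `ℝ≥0∞`-valued (`→ 0` in `[0, ∞]`). Definitions only; no facts.

## References

* [Ellithy2026] A. Ellithy, arXiv:2605.18730 (2026), §3.4, Definition 3.28, Remark 3.30, p. 34.
-/

noncomputable section

open Set Filter MeasureTheory
open scoped ENNReal Topology

namespace Literature.Geometry.Lorentzian

namespace ADMTailTuple

variable (S : ADMTailTuple)

/-- **`G_{r₁}(T) := ∫_{r₁}^∞ 𝔛₀(r, T)/r dr`** (Ellithy 2026, §3.4, p. 34). [cite: Ellithy2026, Def. 3.28 p. 34] -/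
def tailG (Tlo r₁ T : ℝ) : ℝ≥0∞ :=
  ∫⁻ r in Ioi r₁, S.X0 Tlo r T / ENNReal.ofReal r

/-- **`Φ_{1,r₁}(T) := ∫_{r₁}^∞ 𝔛₁(r, T) dr`** (Ellithy 2026, §3.4, p. 34). [cite: Ellithy2026, Def. 3.28 p. 34] -/
def tailPhi1 (Tlo r₁ T : ℝ) : ℝ≥0∞ :=
  ∫⁻ r in Ioi r₁, S.X1 Tlo r T

/-- **`Φ_{2,r₁}(T) := ∫_{r₁}^∞ 𝔛₂(r, T) dr`** (Ellithy 2026, §3.4, p. 34). [cite: Ellithy2026, Def. 3.28 p. 34] -/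
def tailPhi2 (Tlo r₁ T : ℝ) : ℝ≥0∞ :=
  ∫⁻ r in Ioi r₁, S.X2 Tlo r T

/-- **`Ω_{r₁}(T) := sup_{r ≥ r₁} 𝔛₀(r, T)`** (Ellithy 2026, §3.4, p. 34). [cite: Ellithy2026, Def. 3.28 p. 34] -/
def tailOmega (Tlo r₁ T : ℝ) : ℝ≥0∞ :=
  ⨆ (r : ℝ) (_ : r₁ ≤ r), S.X0 Tlo r T

open scoped Classical in
/-- **`Ψ_{r₁}(T) := sup_{t ≥ T} ‖r Ξ(t, ·)‖_{C^{α,α/2}_{-τ}(M_{r₁,∞})}`** (Ellithy 2026, §3.4, p. 34;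
`t ≥ T, t > T̲`), `⊤` unless the forcing is classically defined (`ForcingRegularAt 0`) on the region.
[cite: Ellithy2026, Def. 3.28 p. 34] -/
def tailPsi (α τ Tlo r₁ T : ℝ) : ℝ≥0∞ :=
  if ∀ t, T ≤ t → Tlo < t → ∀ r, r₁ < r → ∀ p, S.ForcingRegularAt 0 t r p then
    ⨆ (t : ℝ) (_ : T ≤ t) (_ : Tlo < t),
      czWeightedNorm α τ (Ioi r₁) (fun r p ↦ r * S.forcing t r p)
  else ⊤

/-- **(A1)**: for every `r₁ > r₀`, `G_{r₁}(T) → 0` and `Φ_{1,r₁}(T) → 0` as `T → ∞` (Ellithy 2026,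
Def. 3.28, first item, p. 34; Remark 3.30: "the basic continuation assumption").
[cite: Ellithy2026, Def. 3.28 (A1) p. 34] -/
def ForcingDecayA1 (Tlo r₀ : ℝ) : Prop :=
  ∀ r₁, r₀ < r₁ →
    Tendsto (fun T ↦ S.tailG Tlo r₁ T) atTop (𝓝 0) ∧ Tendsto (fun T ↦ S.tailPhi1 Tlo r₁ T) atTop (𝓝 0)

/-- **(A2)**: for every `r₁ > r₀`, `Φ_{2,r₁}(T) → 0` and `Ω_{r₁}(T) → 0` as `T → ∞` (Ellithy 2026,
Def. 3.28, second item, p. 34). [cite: Ellithy2026, Def. 3.28 (A2) p. 34] -/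
def ForcingDecayA2 (Tlo r₀ : ℝ) : Prop :=
  ∀ r₁, r₀ < r₁ →
    Tendsto (fun T ↦ S.tailPhi2 Tlo r₁ T) atTop (𝓝 0) ∧
      Tendsto (fun T ↦ S.tailOmega Tlo r₁ T) atTop (𝓝 0)

/-- **(A3)**: for every `r₁ > r₀`, `Ψ_{r₁}(T) → 0` as `T → ∞` (Ellithy 2026, Def. 3.28, third item,
p. 34). [cite: Ellithy2026, Def. 3.28 (A3) p. 34] -/
def ForcingDecayA3 (α τ Tlo r₀ : ℝ) : Prop :=
  ∀ r₁, r₀ < r₁ → Tendsto (fun T ↦ S.tailPsi α τ Tlo r₁ T) atTop (𝓝 0)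

/-- **The late-time forcing decay assumed in the quasi final state hypothesis**: "(A1) holds, and in
addition either (A2) or (A3) holds" (Ellithy 2026, Def. 4.4, bullet 2, p. 39; Thm. 3.31 (iii)).
[cite: Ellithy2026, Def. 4.4 p. 39] -/
def HasLateForcingDecay (α τ Tlo r₀ : ℝ) : Prop :=
  S.ForcingDecayA1 Tlo r₀ ∧ (S.ForcingDecayA2 Tlo r₀ ∨ S.ForcingDecayA3 α τ Tlo r₀)

/-- The forcing decay of Def. 4.4 contains (A1). [cite: Ellithy2026, Def. 4.4 p. 39] -/
theorem HasLateForcingDecay.a1 {S : ADMTailTuple} {α τ Tlo r₀ : ℝ}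
    (h : S.HasLateForcingDecay α τ Tlo r₀) : S.ForcingDecayA1 Tlo r₀ := h.1

/-- The forcing decay of Def. 4.4 contains (A2) or (A3). [cite: Ellithy2026, Def. 4.4 p. 39] -/
theorem HasLateForcingDecay.a2_or_a3 {S : ADMTailTuple} {α τ Tlo r₀ : ℝ}
    (h : S.HasLateForcingDecay α τ Tlo r₀) :
    S.ForcingDecayA2 Tlo r₀ ∨ S.ForcingDecayA3 α τ Tlo r₀ := h.2

end ADMTailTuple

end Literature.Geometry.Lorentzian

end
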